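import Literature.AlgebraicGeometry.ShimuraVarieties.UnitaryAuxiliaryHeckeQuotientDescent
import Literature.AlgebraicGeometry.ShimuraVarieties.UnitaryShimuraCanonicalModelArtin
import Literature.AlgebraicGeometry.ShimuraVarieties.UnitaryAuxiliaryReflexArtinNorm
import Literature.AlgebraicGeometry.ShimuraVarieties.UnitaryShimuraReciprocityTwistInvariance
import Literature.AlgebraicGeometry.ShimuraVarieties.UnitaryAuxiliaryTorusClassNumberProofs
import Literature.AlgebraicGeometry.ShimuraVarieties.UnitaryAuxiliaryTorusUnitLevel
import Literature.NumberTheory.GaloisRepresentations.NormResidueSymbolIdentityComponent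
import Literature.AlgebraicGeometry.ShimuraVarieties.UnitaryAuxiliaryTorusDatumExt
import HarnessLib


/-!
# The Hecke-quotient glue of `hDel` over the TWISTED auxiliary carriers: F1-ext ⟹ an `E`-form of `Sh(U(H), 𝔹²)_ℂ`
# with Shimura reciprocity (62) for `Aut(ℂ/E)` and `L`-idèles — every CM extension `M ⊇ L`, adapted `Φ`, `E ⊇ τ(L)·E*(Φ)`
# ([Deligne 1971] (5.11.1); [Deligne 1979] 2.3.1/2.2.5 for the datum of 2.3.9–2.3.10; [Milne 2005] Def. 12.8 (59)–(62))

Topic `AlgebraicGeometry/ShimuraVarieties`; namespace `Literature.AlgebraicGeometry.ShimuraVarieties.UnitaryCanonicalModel.HeckeQuotientExt`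
(sequel of `UnitaryAuxiliaryHeckeQuotientDescent` — B-p07's generic `HeckeQuotient.quotientReciprocityDescent` — and of B-typ04's
`UnitaryAuxiliaryTorusDatumExt` — the Ext carriers `complexSystemExt / translMorExt / IsCanonicalDescentAtExt` and the named fact
`Aux.canonicalModel_exists_ext_printed`).  THEOREMS ONLY (three private categorical glue lemmas re-proved from the v10b skeleton §4);
no definition, no named fact, no instance.  Cell hodgecm-mathlib, binder `hDel` (crux `HDel` = stmt-HodgeConjecture-24835), cut of record
v12 «K-TWIST» (A-p05 g3 proposal 2026-08-28T05:27:30Z; director g2 ruling 05:35:20Z), piece P3.  HC_CM is proved only modulo the 7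
printed citations until rung 0 closes — everything here is conditional on F1-ext where it says so, and on nothing else.

## What is proved

* §2 `exists_finiteIdele_isArtinCorrespondent_of_forall_mem` — Artin surjectivity over ANY number field `E ⊆ ℂ` containing `τ(L)`
  (`L` CM ⇒ `E` totally complex, Mathlib `isTotallyComplex_of_algebra`; then the tree's `exists_absoluteGaloisGroup_restrict` and
  `exists_finiteIdele_absGaloisAbProj_eq_theta_inv`), generalising A-p05 g0's `Aux.exists_finiteIdele_isArtinCorrespondent_reflexField`
  (the case `E = E♯(Φ)`).
* §3 `isCanonicalDescentOver_of_extData` — the v10b §6 + §8 composition re-run on the Ext carriers: from an `E`-form `(N, ρ, e)` of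
  `∐_{T₀(M)(ℚ)\T₀(M)(𝔸_f)/L₀} Sc.Mc` with the twisted reciprocity `Aux.IsCanonicalDescentAtExt M Φ E hE L₀ Sc N e` (σ ∈ `Aut(ℂ/E)`,
  `E`-idèles, torus coordinate `N_{E,Φ}(s)`), the finite Hecke quotient `N/Δ` is an `E`-form of `Sc.Mc` with Milne's (62) for
  `L`-idèles (`IsCanonicalDescentOver Sc (algebraMap ↥E ℂ)`): test relations = diagonal special pairs; for an `L`-idèle `s` of `σ` pick
  an `E`-idèle `s₁` (§2), `art_L(N_{E/L} s₁) = σ|` (`IsArtinCorrespondent.finiteIdeleRelNorm`), twist `d₁` by `r_x(N s₁)`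
  (`exists_isDiagTwist_recipFactor`), `t = N_{E,Φ}(s₁) ∈ T₀(M)(𝔸_f)` (`Aux.reflexNormFiniteIdele_mem_torusFinAdelic_of_le`, needs
  `E*(Φ) ≤ E`), `δ' = [t]·δ`, and `[x, d₁a] = [x, da]` (`kernelTwistInvariance`); projectivity of `N_K` derived (coproduct of projectives,
  `IsProjectiveOver.of_baseChange_holds`).
* `isCanonicalDescentOver_of_ext_printed (hF1e)` / `exists_isCanonicalDescentOver_of_ext_printed (hF1e)` (`L₀ := Aux.unitLevel M`,
  `Aux.finite_classGroup_printed_holds`) — the `hMᵢ` inputs of `Summit.HodgeConjecture.CorCM.HypDel.isCanonicalDescentAt_of_descentToIntersection_of_pair`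
  for the K-twist closing file.

## References
* [Deligne1971TravauxShimura] P. Deligne, *Travaux de Shimura*, Sém. Bourbaki 389 (1971): Prop. 5.11, (5.11.1), Cor. 5.7.
* [Deligne1979ShimuraVarieties] P. Deligne, *Variétés de Shimura*, PSPM 33.2 (1979): 2.2.5, 2.3.1, 2.3.9–2.3.10 (Milne's transl. pp. 29, 32–33).
* [Milne2005ShimuraVarieties] J. S. Milne, *Introduction to Shimura varieties* (2005): (59) p. 107, Def. 12.8 (62) p. 114, Rem. 12.9.
* [Shimura1998] G. Shimura, *Abelian Varieties with Complex Multiplication* (1998), §18.3.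
-/

set_option autoImplicit false

noncomputable section

open Function MulAction Topology NumberField IsDedekindDomain CategoryTheory CategoryTheory.Limits Matrix
  AlgebraicGeometry
open scoped Matrix ComplexOrder
open Literature.AlgebraicGeometry.Motives
open Literature.NumberTheory.Automorphic Literature.NumberTheory.Automorphic.UnitaryGroup
open Literature.NumberTheory.Automorphic.ShimuraDissection
open Literature.NumberTheory.Automorphic.Liu2021.AppendixC (C5.OpenCompactSubgroup C5.SmallLevel)
open Literature.Geometry.ComplexHyperbolic Literature.Geometry.ComplexHyperbolic.BallModel
open Literature.NumberTheory.ComplexMultiplication (traceField reflexNormFiniteIdele)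
open Literature.NumberTheory.AdelicBaseChange (finiteIdeleRelNorm)

namespace Literature.AlgebraicGeometry.ShimuraVarieties

namespace UnitaryCanonicalModel

namespace HeckeQuotientExt

open Literature.NumberTheory.GaloisRepresentations

/-! ### §1. Glue lemmas (private re-proofs of the tree's private ones) -/

/-- Bookkeeping: an endomorphism `a` intertwined with `b` through a natural isomorphism `e` is intertwined through
`e⁻¹` the other way. [folklore] -/
private theorem inv_app_comp_eq {J C : Type*} [Category J] [Category C] {F G : J ⥤ C} (e : F ≅ G) (j : J)
    {a : F.obj j ⟶ F.obj j} {b : G.obj j ⟶ G.obj j} (h : a ≫ e.hom.app j = e.hom.app j ≫ b) :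
    e.inv.app j ≫ a = b ≫ e.inv.app j := by
  rw [← cancel_mono (e.hom.app j), Category.assoc, h, e.inv_hom_id_app_assoc, Category.assoc, e.inv_hom_id_app,
    Category.comp_id]

/-- Bookkeeping: a natural family `κ_j : S_j ⟶ G_j` composed with `e⁻¹ : G ≅ F` is natural. [folklore] -/
private theorem comp_inv_app_natural {J C : Type*} [Category J] [Category C] {S F G : J ⥤ C} (e : F ≅ G)
    (κ : ∀ j, S.obj j ⟶ G.obj j) (hκ : ∀ {j j' : J} (f : j ⟶ j'), κ j ≫ G.map f = S.map f ≫ κ j')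
    {j j' : J} (f : j ⟶ j') : (κ j ≫ e.inv.app j) ≫ F.map f = S.map f ≫ κ j' ≫ e.inv.app j' := by
  rw [Category.assoc, ← e.inv.naturality f, reassoc_of% (hκ f)]

/-- Bookkeeping: with `e`, `a`, `b` as in `inv_app_comp_eq`, a pair `κ₁ ≫ b = κ₂` gives
`(κ₁ ≫ e⁻¹) ≫ a = κ₂ ≫ e⁻¹`. [folklore] -/
private theorem comp_inv_app_comp_eq {J C : Type*} [Category J] [Category C] {F G : J ⥤ C} (e : F ≅ G) (j : J) {X : C}
    {κ₁ κ₂ : X ⟶ G.obj j} {a : F.obj j ⟶ F.obj j} {b : G.obj j ⟶ G.obj j}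
    (h : a ≫ e.hom.app j = e.hom.app j ≫ b) (hκ : κ₁ ≫ b = κ₂) :
    (κ₁ ≫ e.inv.app j) ≫ a = κ₂ ≫ e.inv.app j := by
  rw [Category.assoc, inv_app_comp_eq e j h, ← Category.assoc, hκ]

/-! ### §2. Artin surjectivity over ANY number field `E ⊆ ℂ` containing `τ(L)` -/

/-- **Every `σ ∈ Aut(ℂ/E)` has an Artin-correspondent finite idèle of `E`**, for every number field `E ⊆ ℂ` containing
`τ(L)` (`L` CM, so `E` is totally complex): Galois half `exists_absoluteGaloisGroup_restrict`, idèle half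
`exists_finiteIdele_absGaloisAbProj_eq_theta_inv`. [cite: Milne2005ShimuraVarieties, p. 107 L9–15 and (59)]
[cite: Deligne1979ShimuraVarieties, 0.8 and 2.2.3] -/
theorem exists_finiteIdele_isArtinCorrespondent_of_forall_mem {L : Type} [Field L] [NumberField L] [IsCMField L]
    (τ : L →+* ℂ) (E : IntermediateField ℚ ℂ) [FiniteDimensional ℚ ↥E] (hE : ∀ x : L, τ x ∈ E) (σ : ℂ ≃+* ℂ)
    (hσ : ∀ y : ↥E, σ (algebraMap ↥E ℂ y) = algebraMap ↥E ℂ y) :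
    haveI : NumberField ↥E := NumberField.mk
    ∃ s : (FiniteAdeleRing (𝓞 ↥E) ↥E)ˣ, IsArtinCorrespondent ↥E (algebraMap ↥E ℂ) s σ := by
  haveI : NumberField ↥E := NumberField.mk
  letI : Algebra L ↥E := (Aux.toFieldOfMem τ E hE).toAlgebra
  haveI : IsTotallyComplex ↥E := isTotallyComplex_of_algebra L ↥E
  obtain ⟨e, γ, he⟩ := exists_absoluteGaloisGroup_restrict ↥E (algebraMap ↥E ℂ) σ hσ
  obtain ⟨s, hs⟩ := exists_finiteIdele_absGaloisAbProj_eq_theta_inv γ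
  exact ⟨s, e, γ, he, hs⟩

/-! ### §3. The Hecke-quotient glue over the Ext carriers -/

set_option maxHeartbeats 1600000 in -- large adelic / Shimura-set binders
/-- **F1-ext data ⟹ an `E`-form of `Sc.Mc` with Shimura reciprocity (62) for `Aut(ℂ/E)` and `L`-idèles** — the finite Hecke
quotient ([Deligne1971TravauxShimura] (5.11.1)) of an `E`-form of `∐_{T₀(M)(ℚ)\T₀(M)(𝔸_f)/L₀} Sc.Mc` carrying the twisted reciprocity
`Aux.IsCanonicalDescentAtExt` (σ ∈ `Aut(ℂ/E)`, `E`-idèles, precise torus coordinate), by the tree's generic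
`HeckeQuotient.quotientReciprocityDescent` with the test relations of (62) for `L`-idèles: for an `L`-idèle `s` with
`art_L(s) = σ|`, pick an `E`-idèle `s₁` for `σ` (§2), push it down (`art_L(N_{E/L}s₁) = σ|`, tree
`IsArtinCorrespondent.finiteIdeleRelNorm`), twist by `r_x(N s₁)` (`exists_isDiagTwist_recipFactor`), read the F1-ext clause
with `t = N_{E,Φ}(s₁) ∈ T₀(M)(𝔸_f)` (`Aux.reflexNormFiniteIdele_mem_torusFinAdelic_of_le`, needs `E*(Φ) ≤ E`), and compare
the two twists by kernel-twist invariance (`kernelTwistInvariance`).  Projectivity of `N_K` is derived (coproduct of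
projectives, descended along `E → ℂ`). [cite: Deligne1971TravauxShimura, Prop. 5.11, (5.11.1), Cor. 5.7]
[cite: Milne2005ShimuraVarieties, Def. 12.8 (59)–(62) pp. 107–114] [cite: Deligne1979ShimuraVarieties, 2.2.5, 2.3.1, 2.3.10] -/
theorem isCanonicalDescentOver_of_extData
    {L : Type} [Field L] [NumberField L] [IsCMField L] (H : Matrix (Fin 3) (Fin 3) L) (τ : L →+* ℂ)
    (T : GL (Fin 3) ℂ) (hT : formCongr (starRingEnd ℂ) T (H.map τ) = BallModel.J)
    (K₀ : C5.OpenCompactSubgroup ↥(finAdelic (↥(maximalRealSubfield L)) L (IsCMField.complexConj L) 3 H))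
    (Sc : ComplexRecordSystem L H τ T hT K₀) (M : Type) [Field M] [NumberField M] [IsCMField M] (Φ : CMType M)
    (E : IntermediateField ℚ ℂ) [FiniteDimensional ℚ ↥E] (hE : ∀ x : L, τ x ∈ E) (hΦE : traceField Φ ≤ E)
    (L₀ : C5.OpenCompactSubgroup ↥(Aux.torusFinAdelic M)) [Finite (Aux.classGroup M L₀)]
    (hdata : ∃ (N : C5.SmallLevel K₀ ⥤ SchemeOver ↥E)
        (ρ : ∀ K : C5.SmallLevel K₀, Aux.classGroup M L₀ →* Aut (N.obj K))
        (e : (N ⋙ Motives.baseChange ↥E ℂ) ≅ Aux.complexSystemExt M Sc L₀),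
        (∀ (K K' : C5.SmallLevel K₀) (f : K ⟶ K') (c : Aux.classGroup M L₀),
            (ρ K c).hom ≫ N.map f = N.map f ≫ (ρ K' c).hom) ∧
        (∀ (K : C5.SmallLevel K₀) (c : Aux.classGroup M L₀),
            (Motives.baseChange ↥E ℂ).map (ρ K c).hom ≫ e.hom.app K = e.hom.app K ≫ Aux.translMorExt M Sc L₀ K c) ∧
        Aux.IsCanonicalDescentAtExt M Φ E hE L₀ Sc N e) :
    ∃ (M' : C5.SmallLevel K₀ ⥤ SchemeOver ↥E) (e' : (M' ⋙ Motives.baseChange ↥E ℂ) ≅ Sc.Mc),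
      IsCanonicalDescentOver Sc (algebraMap ↥E ℂ) M' e' := by
  obtain ⟨N, ρ, e, hρ, hρe, hExt⟩ := hdata
  haveI : NumberField ↥E := NumberField.mk
  letI : Algebra L ↥E := (Aux.toFieldOfMem τ E hE).toAlgebra
  letI : Fintype (Aux.classGroup M L₀) := Fintype.ofFinite _
  -- projectivity of the `E`-models `N_K`: `∐ Sc.Mc_K` is projective, transported along `e_K`, descended
  have hN : ∀ K : C5.SmallLevel K₀, IsProjectiveOver (N.obj K) := fun K => by
    have hcop : IsProjectiveOver ((Aux.complexSystemExt M Sc L₀).obj K) :=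
      Motives.isProjectiveOver_of_isColimit_cofan (coproductIsCoproduct fun _ : Aux.classGroup M L₀ => Sc.Mc.obj K)
        fun _ => Sc.projective K
    have hbc : IsProjectiveOver ((N ⋙ Motives.baseChange ↥E ℂ).obj K) := by
      obtain ⟨n, κ', hκ'⟩ := hcop
      haveI := hκ'
      haveI : IsIso (e.app K).hom.left := (inferInstance : IsIso ((Over.forget _).mapIso (e.app K)).hom)
      exact ⟨n, (e.app K).hom ≫ κ', inferInstanceAs (IsClosedImmersion ((e.app K).hom.left ≫ κ'.left))⟩
    exact Motives.IsProjectiveOver.of_baseChange_holds (N.obj K) ℂ hbc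
  have hMc : ∀ K : C5.SmallLevel K₀, IsSeparated (Sc.Mc.obj K).hom := fun K => by
    haveI : IsProper (Sc.Mc.obj K).hom := Motives.IsProjectiveOver.isProper (Sc.projective K)
    infer_instance
  -- the coprojections, as morphisms into `(Aux.complexSystemExt M Sc L₀).obj K`
  let κ : ∀ K : C5.SmallLevel K₀, Aux.classGroup M L₀ → (Sc.Mc.obj K ⟶ (Aux.complexSystemExt M Sc L₀).obj K) :=
    fun K p => Limits.Sigma.ι (fun _ : Aux.classGroup M L₀ => Sc.Mc.obj K) p
  have hκnat : ∀ (p : Aux.classGroup M L₀) {K K' : C5.SmallLevel K₀} (f : K ⟶ K'),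
      κ K p ≫ (Aux.complexSystemExt M Sc L₀).map f = Sc.Mc.map f ≫ κ K' p :=
    fun p K K' f => Limits.Sigma.ι_map (fun _ : Aux.classGroup M L₀ => Sc.Mc.map f) p
  have hκρ : ∀ (K : C5.SmallLevel K₀) (c p : Aux.classGroup M L₀), κ K p ≫ Aux.translMorExt M Sc L₀ K c = κ K (c * p) :=
    fun K c p => Limits.Sigma.ι_desc _ _
  -- the cofans `ι_K p := κ_K p ≫ e⁻¹_K`
  let ι : ∀ K : C5.SmallLevel K₀, Aux.classGroup M L₀ → (Sc.Mc.obj K ⟶ (N ⋙ Motives.baseChange ↥E ℂ).obj K) :=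
    fun K p => κ K p ≫ e.inv.app K
  have hιdef : ∀ (K : C5.SmallLevel K₀) (p : Aux.classGroup M L₀), ι K p = κ K p ≫ e.inv.app K := fun K p => rfl
  have hκdef : ∀ (K : C5.SmallLevel K₀) (p : Aux.classGroup M L₀),
      κ K p = Limits.Sigma.ι (fun _ : Aux.classGroup M L₀ => Sc.Mc.obj K) p := fun K p => rfl
  have hι : ∀ K : C5.SmallLevel K₀, Nonempty (IsColimit (Cofan.mk ((N ⋙ Motives.baseChange ↥E ℂ).obj K) (ι K))) :=
    fun K => ⟨IsColimit.ofIsoColimit (coproductIsCoproduct fun _ : Aux.classGroup M L₀ => Sc.Mc.obj K)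
      (Cofan.ext (e.app K).symm (fun p => rfl))⟩
  have hιnat : ∀ (K K' : C5.SmallLevel K₀) (f : K ⟶ K') (p : Aux.classGroup M L₀),
      ι K p ≫ (N ⋙ Motives.baseChange ↥E ℂ).map f = Sc.Mc.map f ≫ ι K' p :=
    fun K K' f p => comp_inv_app_natural (S := Sc.Mc) e (fun K => κ K p) (fun f => hκnat p f) f
  have hιρ : ∀ (K : C5.SmallLevel K₀) (c p : Aux.classGroup M L₀),
      ι K p ≫ (Motives.baseChange ↥E ℂ).map (ρ K c).hom = ι K (c * p) :=
    fun K c p => comp_inv_app_comp_eq e K (hρe K c) (hκρ K c p)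
  -- hermitian symmetry of `H` (for the existence of twists)
  have hH : ∀ i j, cmConjRingHom L (H i j) = H j i := cmConjRingHom_apply_eq_of_formCongr_eq_J L H τ T hT
  -- the test relations: Milne's (62) at the diagonal special pairs, for `L`-idèles
  let R : ∀ K : C5.SmallLevel K₀, (ℂ ≃ₐ[↥E] ℂ) → ComplexPoints (Sc.Mc.obj K) → ComplexPoints (Sc.Mc.obj K) → Prop :=
    fun K σ u u' => ∃ (s : (FiniteAdeleRing (𝓞 L) L)ˣ) (v₃ : Fin 3 → L) (x : Ball)
      (d a : finAdelic (↥(maximalRealSubfield L)) L (IsCMField.complexConj L) 3 H),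
      IsArtinCorrespondent L τ s σ.toRingEquiv ∧ IsLinePoint L τ T v₃ x ∧ IsDiagTwist L H v₃ (recipFactor L s) d ∧
        u = (Sc.pts K).symm (ShimuraSet.mk L H τ T hT K.1.1 x a) ∧
        u' = (Sc.pts K).symm (ShimuraSet.mk L H τ T hT K.1.1 x (d * a))
  have hrecR : ∀ (K : C5.SmallLevel K₀) (σ : ℂ ≃ₐ[↥E] ℂ) (u u' : ComplexPoints (Sc.Mc.obj K)),
      R K σ u u' → ∀ p : Aux.classGroup M L₀, ∃ p' : Aux.classGroup M L₀,
        σ • (formPointsEquiv (N.obj K)).symm (AlgPoints.map (ι K p) u) =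
          (formPointsEquiv (N.obj K)).symm (AlgPoints.map (ι K p') u') := by
    rintro K σ u u' ⟨s, v₃, x, d, a, hs, hx, hd, rfl, rfl⟩ p
    -- an `E`-idèle for `σ` and its norm, Artin-correspondent to `σ` over `L`
    obtain ⟨s₁, hs₁⟩ := exists_finiteIdele_isArtinCorrespondent_of_forall_mem τ E hE σ.toRingEquiv fun y => σ.commutes y
    have hs₁' : IsArtinCorrespondent L τ (finiteIdeleRelNorm L ↥E s₁) σ.toRingEquiv :=
      IsArtinCorrespondent.finiteIdeleRelNorm (fun x => rfl) hs₁
    -- the twist of the norm exists (`v₃` anisotropic from the line point)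
    obtain ⟨d₁, hd₁⟩ := exists_isDiagTwist_recipFactor H v₃ hH (hermForm_self_ne_zero_of_isLinePoint L H τ T hT hx)
      (finiteIdeleRelNorm L ↥E s₁)
    -- the torus coordinate `t = N_{E,Φ}(s₁) ∈ T₀(M)(𝔸_f)` (g4 over `E ⊇ E*(Φ)`)
    let t : ↥(Aux.torusFinAdelic M) :=
      ⟨reflexNormFiniteIdele M Φ E s₁, Aux.reflexNormFiniteIdele_mem_torusFinAdelic_of_le M Φ E hΦE s₁⟩
    refine ⟨Aux.classOf M L₀ t * p, ?_⟩
    have key := hExt K σ s₁ hs₁ v₃ x hx d₁ hd₁ t rfl a p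
    have hk := kernelTwistInvariance L H τ T hT K₀ K σ.toRingEquiv s (finiteIdeleRelNorm L ↥E s₁) hs hs₁' v₃ x hx d d₁
      hd hd₁ a
    rw [hιdef, hιdef, hκdef, hκdef, hk]
    erw [AlgPoints.map_comp_apply, AlgPoints.map_comp_apply]
    exact key
  obtain ⟨M', e', hM⟩ := HeckeQuotient.quotientReciprocityDescent ↥E (C5.SmallLevel K₀) Sc.Mc hMc (Aux.classGroup M L₀)
    N hN ρ hρ ι hι hιnat hιρ R hrecR
  refine ⟨M', e', ?_⟩
  intro K σ s hs v₃ x hx d hd a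
  exact hM K σ _ _ ⟨s, v₃, x, d, a, hs, hx, hd, rfl, rfl⟩

/-- **F1-ext ⟹ the `E`-form with (62), for every adapted twist** — `isCanonicalDescentOver_of_extData` applied to the conclusion
of the named fact `Aux.canonicalModel_exists_ext_printed` ([Deligne1979ShimuraVarieties] 2.3.1/2.2.5 for the twisted Hodge-type
datum). [cite: Deligne1979ShimuraVarieties, 2.3.1, 2.2.5, 2.3.10] [cite: Deligne1971TravauxShimura, (5.11.1)] -/
theorem isCanonicalDescentOver_of_ext_printed (hF1e : Aux.canonicalModel_exists_ext_printed)
    {L : Type} [Field L] [NumberField L] [IsCMField L] (H : Matrix (Fin 3) (Fin 3) L) (τ : L →+* ℂ)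
    (T : GL (Fin 3) ℂ) (hT : formCongr (starRingEnd ℂ) T (H.map τ) = BallModel.J)
    (hpos : ∀ τ' : L →+* ℂ, InfinitePlace.mk τ' ≠ InfinitePlace.mk τ → (H.map τ').PosDef)
    (hanis : ∀ v : Fin 3 → L, hermForm (cmConjRingHom L) H v v = 0 → v = 0)
    (K₀ : C5.OpenCompactSubgroup ↥(finAdelic (↥(maximalRealSubfield L)) L (IsCMField.complexConj L) 3 H))
    (htf : ∀ g : finAdelic (↥(maximalRealSubfield L)) L (IsCMField.complexConj L) 3 H,
      ∀ γ ∈ arithmeticLevel (↥(maximalRealSubfield L)) L (IsCMField.complexConj L) 3 H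
        (K₀.1.map (MulAut.conj g).toMonoidHom), IsOfFinOrder γ → γ = 1)
    (Sc : ComplexRecordSystem L H τ T hT K₀) (M : Type) [Field M] [NumberField M] [IsCMField M] (j : L →+* M)
    (Φ : CMType M) (hΦ : Aux.IsExtAdapted τ j Φ)
    (E : IntermediateField ℚ ℂ) [FiniteDimensional ℚ ↥E] (hE : ∀ x : L, τ x ∈ E) (hΦE : traceField Φ ≤ E)
    (L₀ : C5.OpenCompactSubgroup ↥(Aux.torusFinAdelic M)) [Finite (Aux.classGroup M L₀)] :
    ∃ (M' : C5.SmallLevel K₀ ⥤ SchemeOver ↥E) (e' : (M' ⋙ Motives.baseChange ↥E ℂ) ≅ Sc.Mc),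
      IsCanonicalDescentOver Sc (algebraMap ↥E ℂ) M' e' :=
  isCanonicalDescentOver_of_extData H τ T hT K₀ Sc M Φ E hE hΦE L₀
    (hF1e L H τ T hT hpos hanis K₀ htf Sc M j Φ hΦ E hE hΦE L₀)

/-- **F1-ext ⟹ the `E`-form with (62), at the unit level `L₀ := Aux.unitLevel M` of `T₀(M)`** (class-group finiteness
discharged by `Aux.finite_classGroup_printed_holds`): the shape the K-twist closing file consumes at `E := τ(L)(i√p)`.
[cite: Deligne1979ShimuraVarieties, 2.3.1, 2.2.5, 2.3.10] [cite: Deligne1971TravauxShimura, (5.11.1)] -/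
theorem exists_isCanonicalDescentOver_of_ext_printed (hF1e : Aux.canonicalModel_exists_ext_printed)
    {L : Type} [Field L] [NumberField L] [IsCMField L] (H : Matrix (Fin 3) (Fin 3) L) (τ : L →+* ℂ)
    (T : GL (Fin 3) ℂ) (hT : formCongr (starRingEnd ℂ) T (H.map τ) = BallModel.J)
    (hpos : ∀ τ' : L →+* ℂ, InfinitePlace.mk τ' ≠ InfinitePlace.mk τ → (H.map τ').PosDef)
    (hanis : ∀ v : Fin 3 → L, hermForm (cmConjRingHom L) H v v = 0 → v = 0)
    (K₀ : C5.OpenCompactSubgroup ↥(finAdelic (↥(maximalRealSubfield L)) L (IsCMField.complexConj L) 3 H))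
    (htf : ∀ g : finAdelic (↥(maximalRealSubfield L)) L (IsCMField.complexConj L) 3 H,
      ∀ γ ∈ arithmeticLevel (↥(maximalRealSubfield L)) L (IsCMField.complexConj L) 3 H
        (K₀.1.map (MulAut.conj g).toMonoidHom), IsOfFinOrder γ → γ = 1)
    (Sc : ComplexRecordSystem L H τ T hT K₀) (M : Type) [Field M] [NumberField M] [IsCMField M] (j : L →+* M)
    (Φ : CMType M) (hΦ : Aux.IsExtAdapted τ j Φ)
    (E : IntermediateField ℚ ℂ) [FiniteDimensional ℚ ↥E] (hE : ∀ x : L, τ x ∈ E) (hΦE : traceField Φ ≤ E) :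
    ∃ (M' : C5.SmallLevel K₀ ⥤ SchemeOver ↥E) (e' : (M' ⋙ Motives.baseChange ↥E ℂ) ≅ Sc.Mc),
      IsCanonicalDescentOver Sc (algebraMap ↥E ℂ) M' e' := by
  haveI : Finite (Aux.classGroup M (Aux.unitLevel M)) := Aux.finite_classGroup_printed_holds M (Aux.unitLevel M)
  exact isCanonicalDescentOver_of_ext_printed hF1e H τ T hT hpos hanis K₀ htf Sc M j Φ hΦ E hE hΦE (Aux.unitLevel M)

end HeckeQuotientExt

end UnitaryCanonicalModel

end Literature.AlgebraicGeometry.ShimuraVarieties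

end
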